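import Literature.MathematicalPhysics.QuantumFieldTheory.Balaban1983to89.B9SectCCubes

/-! # `Balaban1983to89.B9SectCLocalSeq` — B9 Sect. C, p. 408: the LOCAL SEQUENCE OF DOMAINS {Ω_n(□)}_{n=0,…,j+1}
of a localization cube □ ∈ 𝒟_j, typed as sup-norm boxes (radii, printed closed form, shell widths = condition (2.2)
of [4], lattice compatibility, «Ω₀(□) ⊂ □̃⁵» ⟸ K ≥ 2)

CITATION HEADER (lean-in-tree rule 2026-08-18).  Paper sub-cell `b2b-balaban-b09` (gen 9, journal claim
`B9-SECTC-LOCALSEQ`, cell pub-balaban) on T. Bałaban, *Propagators for lattice gauge theories in a background field*,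
Commun. Math. Phys. **99** (1985) 389–434 [`Balaban1985BackgroundPropagators`] (= B9; journal page = PDF page + 388),
p. 408 [PDF 20] (render `b2b-balaban-ref1/pages/1985-cmp99-background-propagators/…-p020-x2.png`, READ AS AN IMAGE by
this unit), with [4] = *Propagators and renormalization transformations for lattice gauge theories. II*, Commun. Math.
Phys. **96** (1984) 223–250 [`Balaban1984PropagatorsII`] (= B6) p. 224 [PDF 2] conditions (2.1), (2.2) (render
`…/1984-cmp96-propagators-rt-II/…-p002-x2.png`, read as an image).  Sibling of `…B9SectCCubes` (the cubes □̃ⁿ, □₀,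
X̃⁵; cell C-B9-49/52) and `…B9SectCRefine` (the partition-of-unity refinement; C-B9-50/51); it imports
`…B9SectCCubes` ONLY (for the sup-norm boxes `box`, `tilde`, `mem_box`, `box_mono` — gate dedup rule) and edits nothing
landed.  The collar ARITHMETIC «Ω₀(□) ⊂ □̃⁵ ⟸ K ≥ 2» is cell C-B9-10 (`B9.p408_domains_fit`, a pure inequality); here
the domains are SETS.

WHAT IS PRINTED (verbatim).
* B9 p. 408: *"We need two different scales, given by two sizes of big blocks. In [4] we have proved all theorems
  under the assumption that R, M are sufficiently large. We take these numbers as powers of L. Let us fix a pair R₀,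
  M₀ of smallest possible numbers satisfying conditions needed in the proofs. We assume that the size M of big blocks
  we are using in this paper is much bigger than M₀, more precisely we assume that M = KR₀M₀, K is a positive
  integer. Thus a big block of the size M can be represented as a union of cubes of the size R₀M₀. Let us take a
  cube □ ∈ 𝒟_j, and let us define a sequence {Ω_n(□)}_{n=0,…,j+1} of domains in the following way. The cube □̃³ is
  either contained in B^j(Λ_j), or intersects also the domain B^{j+1}(Λ_{j+1}). Let us assume the second case, then
  we defined Ω_{j+1}(□) = □̃³ ∩ B^{j+1}(Λ_{j+1}). We take Ω_j(□) = □̃⁴, Ω_{j−1}(□) is a cube with a center at the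
  center of □ and dist (Ω_{j−1}(□)ᶜ, Ω_j(□)) = 2R₀M₀L^{j−1}η, and generally Ω_n(□) is a cube with a center at the
  center of □ and dist(Ω_n(□)ᶜ, Ω_{n+1}(□)) = 2R₀M₀Lⁿη, or dist(Ω_n(□)ᶜ, □̃⁴) = 2R₀M₀Lⁿη + ⋯ + 2R₀M₀L^{j−1}η
  = 2R₀M₀Lⁿη (L^{j−n} − 1/L − 1). This sequence satisfies the conditions (2.1), (2.2) with j instead of k, if
  rescaled from η-lattice to L^{−j}-lattice. For n = 0 we have dist(Ω₀(□)ᶜ, □̃⁴) < 2R₀M₀L^jη, hence Ω₀(□) ⊂ □̃⁵."*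
  (same page, earlier: *"For a cube □ ∈ 𝒟 and n = 1, 2,… we define □̃ⁿ as a cube of the size (2 + 2n)ML^jη, and
  with the same center as □, hence it is a union of (2 + 2n)^d big blocks."*)
* B6 p. 224: *"We consider a sequence of domains Ω₁ ⊃ Ω₂ ⊃ … ⊃ Ω_k, Ω_j ⊂ T_η, j = 1, 2, …, k, (2.1) which satisfy
  the following conditions: Ω_j = B^j(Ω_j^{(j)}), Ω_j^{(j)} ⊂ T^{(j)}_{L^jη} and it is a sum of big blocks,
  (L^jη)^{−1} dist(Ω_j^c, Ω_{j+1}) > RM, M is a size of big blocks and R is a big positive integer which will be fixed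
  later. (2.2)"*

WHAT THIS MODULE TYPES (sup-norm boxes in the continuum envelope ℝ^d of the lattice, as in `B9SectCCubes`; absolute
units: η the lattice spacing, L the scale factor, M = KR₀M₀ the big-block number, □ ∈ 𝒟_j of half-width ML^jη and
centre c).  `collar n` = 2R₀M₀Lⁿη (the printed shell width); `rad n` = 5ML^jη + Σ_{m=n}^{j−1} collar m (half-width of
Ω_n(□), n ≦ j); `Omega c … n` = box c (rad n).
1. `rad_self`, `Omega_top` — Ω_j(□) = □̃⁴ (half-width 5ML^jη).
2. `rad_succ`, `Omega_succ_subset`, `Omega_antitone` — (2.1): Ω_n(□) ⊃ Ω_{n+1}(□), the radii dropping by collar n.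
3. `dist_succ` — *"dist(Ω_n(□)ᶜ, Ω_{n+1}(□)) = 2R₀M₀Lⁿη"* in inclusion form (the closed collar-n neighbourhood of
   Ω_{n+1} lies in Ω_n) and `dist_succ_sharp` (no wider neighbourhood does: the printed distance is attained, d ≧ 1).
4. `sum_collar_eq`, `rad_closed_form` — the printed closed form 2R₀M₀Lⁿη·(L^{j−n} − 1)/(L − 1) (L ≠ 1).
5. `sum_collar_lt` — *"For n = 0 we have dist(Ω₀(□)ᶜ, □̃⁴) < 2R₀M₀L^jη"* (indeed for every n ≦ j), for L ≧ 2 (uses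
   only Σ_{m<j} L^m·(L − 1) = L^j − 1); `Omega_zero_subset_tilde_five` — *"hence Ω₀(□) ⊂ □̃⁵"* under K ≥ 2
   (2R₀M₀ ≦ KR₀M₀ = M); `K_one_counterexample` — with K = 1 the inclusion FAILS (d = 1, L = 2, j = 2,
   R₀ = M₀ = η = 1: Ω₀ = [−26, 26] ⊄ □̃⁵ = [−24, 24]); print's "much bigger than M₀" covers K ≥ 2 (cell C-B9-10).
6. `collar_div_unit`, `cond22_local` — (2.2)'s inequality for the local sequence in the (R, M) ↦ (R₀, M₀) reading of
   p. 408's *"Let us fix a pair R₀, M₀"*: (Lⁿη)^{−1}·dist(Ω_nᶜ, Ω_{n+1}) = 2R₀M₀ > R₀M₀ — satisfied with room.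
7. `rad_eq_natMul`, `face_on_lattice` — (2.2)'s *"it is a sum of big blocks"*: for K, R₀, L ∈ ℕ the half-width rad n
   is a natural multiple of the scale-n block unit M₀Lⁿη, and when the centre lies on the ML^jη-lattice both faces
   c_i ± rad n lie on the M₀Lⁿη-lattice (so Ω_n(□) is a union of cells of that lattice — the union itself is not spelled
   out).
8. `case2_top_subset`, `case2_top_dist` — the second case's top step: Ω_{j+1}(□) = □̃³ ∩ B^{j+1}(Λ_{j+1}) ⊆ □̃³, and
   the closed ML^jη-neighbourhood of □̃³ lies in □̃⁴ = Ω_j(□) (margin M·L^jη = KR₀M₀L^jη ≧ 2R₀M₀L^jη for K ≥ 2).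
SCOPE (candid).  Pure coordinate-box arithmetic; the sets B^j(Λ_j), the operation Ω ↦ B^j(Ω^{(j)}), the block lattice
𝔅(□) generated by the local sequence, its multiscale distance (2.46) and the comparison with the global 𝔅 on □̃³ (the
hypotheses `hdist`/`hS` of `B9Eq395Transport` §3) are NOT modelled here — this is the first, set-level slice of that
geometry.  Value = kernel-checked bookkeeping for a print-level construction used across the cell, NOT summit progress.
Cell records: GAPS C-B9-53 (this module), C-B9-10; DIVERGENCE D-b09.37. -/

namespace Literature.MathematicalPhysics.QuantumFieldTheory.Balaban1983to89.B9SectCLocalSeq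

open Finset
open B9SectCCubes (box tilde mem_box box_mono)

variable {d : ℕ}

/-! ## §1  Collars, radii, the domains Ω_n(□) (boxes `box`, cubes `tilde` from `B9SectCCubes`) -/

/-- The printed shell width at scale n: collar n = 2R₀M₀Lⁿη.
[cite: Balaban1985BackgroundPropagators, p. 408 (PDF p. 20), "dist(Ω_n(□)ᶜ, Ω_{n+1}(□)) = 2R₀M₀Lⁿη"] -/
def collar (R₀ M₀ L η : ℝ) (n : ℕ) : ℝ := 2 * R₀ * M₀ * (L ^ n * η)

/-- Half-width of Ω_n(□) for n ≦ j: 5ML^jη (that of □̃⁴, M = KR₀M₀) plus the collars of the scales n, …, j − 1.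
[cite: Balaban1985BackgroundPropagators, p. 408 (PDF p. 20), "dist(Ω_n(□)ᶜ, □̃⁴) = 2R₀M₀Lⁿη + ⋯ + 2R₀M₀L^{j−1}η"] -/
def rad (K R₀ M₀ L η : ℝ) (j n : ℕ) : ℝ :=
  5 * (K * R₀ * M₀) * (L ^ j * η) + ∑ m ∈ Finset.Ico n j, collar R₀ M₀ L η m

/-- The domain Ω_n(□), n ≦ j, of the cube □ ∈ 𝒟_j centred at c: the box of half-width `rad … j n`.
[cite: Balaban1985BackgroundPropagators, p. 408 (PDF p. 20), "Ω_n(□) is a cube with a center at the center of □"] -/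
def Omega (c : Fin d → ℝ) (K R₀ M₀ L η : ℝ) (j n : ℕ) : Set (Fin d → ℝ) := box c (rad K R₀ M₀ L η j n)

/-- Collars are non-negative for non-negative data. [folklore] -/
theorem collar_nonneg {R₀ M₀ L η : ℝ} (hR : 0 ≤ R₀) (hM : 0 ≤ M₀) (hL : 0 ≤ L) (hη : 0 ≤ η) (n : ℕ) :
    0 ≤ collar R₀ M₀ L η n := by
  unfold collar; positivity

/-- Collars are positive for positive data. [folklore] -/
theorem collar_pos {R₀ M₀ L η : ℝ} (hR : 0 < R₀) (hM : 0 < M₀) (hL : 0 < L) (hη : 0 < η) (n : ℕ) :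
    0 < collar R₀ M₀ L η n := by
  unfold collar; positivity

/-! ## §2  Ω_j(□) = □̃⁴ and the nested chain (2.1) -/

/-- At the top scale the sum of collars is empty: rad j = 5ML^jη. [folklore] -/
theorem rad_self (K R₀ M₀ L η : ℝ) (j : ℕ) : rad K R₀ M₀ L η j j = 5 * (K * R₀ * M₀) * (L ^ j * η) := by
  simp [rad]

/-- *"We take Ω_j(□) = □̃⁴"*: the box of half-width 5·ML^jη, M = KR₀M₀.
[cite: Balaban1985BackgroundPropagators, p. 408 (PDF p. 20)] -/
theorem Omega_top (c : Fin d → ℝ) (K R₀ M₀ L η : ℝ) (j : ℕ) :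
    Omega c K R₀ M₀ L η j j = tilde c (K * R₀ * M₀ * (L ^ j * η)) 4 := by
  show box c _ = box c _
  rw [rad_self]
  congr 1
  push_cast
  ring

/-- Going down one scale adds one collar: rad n = rad (n+1) + collar n for n < j.
[cite: Balaban1985BackgroundPropagators, p. 408 (PDF p. 20), "dist(Ω_n(□)ᶜ, Ω_{n+1}(□)) = 2R₀M₀Lⁿη"] -/
theorem rad_succ (K R₀ M₀ L η : ℝ) {j n : ℕ} (h : n < j) :
    rad K R₀ M₀ L η j n = rad K R₀ M₀ L η j (n + 1) + collar R₀ M₀ L η n := by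
  unfold rad
  rw [Finset.sum_eq_sum_Ico_succ_bot h]
  ring

/-- The radii decrease in n (non-negative data): n ≦ m ⇒ rad m ≦ rad n. [folklore] -/
theorem rad_antitone {K R₀ M₀ L η : ℝ} (hR : 0 ≤ R₀) (hM : 0 ≤ M₀) (hL : 0 ≤ L) (hη : 0 ≤ η) (j : ℕ)
    {n m : ℕ} (hnm : n ≤ m) : rad K R₀ M₀ L η j m ≤ rad K R₀ M₀ L η j n := by
  unfold rad
  have hsub : Finset.Ico m j ⊆ Finset.Ico n j := Finset.Ico_subset_Ico_left hnm
  have := Finset.sum_le_sum_of_subset_of_nonneg hsub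
    (fun k _ _ => collar_nonneg hR hM hL hη k)
  linarith

/-- (2.1) one step: Ω_{n+1}(□) ⊆ Ω_n(□). [cite: Balaban1984PropagatorsII, (2.1) p. 224 (PDF p. 2)] -/
theorem Omega_succ_subset (c : Fin d → ℝ) {K R₀ M₀ L η : ℝ} (hR : 0 ≤ R₀) (hM : 0 ≤ M₀) (hL : 0 ≤ L)
    (hη : 0 ≤ η) (j n : ℕ) : Omega c K R₀ M₀ L η j (n + 1) ⊆ Omega c K R₀ M₀ L η j n :=
  box_mono c (rad_antitone hR hM hL hη j (Nat.le_succ n))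

/-- (2.1), the whole chain: Ω₀(□) ⊃ Ω₁(□) ⊃ … ⊃ Ω_j(□), i.e. n ≦ m ⇒ Ω_m(□) ⊆ Ω_n(□).
[cite: Balaban1984PropagatorsII, (2.1) p. 224 (PDF p. 2), "Ω₁ ⊃ Ω₂ ⊃ … ⊃ Ω_k"] -/
theorem Omega_antitone (c : Fin d → ℝ) {K R₀ M₀ L η : ℝ} (hR : 0 ≤ R₀) (hM : 0 ≤ M₀) (hL : 0 ≤ L)
    (hη : 0 ≤ η) (j : ℕ) {n m : ℕ} (hnm : n ≤ m) : Omega c K R₀ M₀ L η j m ⊆ Omega c K R₀ M₀ L η j n :=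
  box_mono c (rad_antitone hR hM hL hη j hnm)

/-! ## §3  The shell widths: dist(Ω_n(□)ᶜ, Ω_{n+1}(□)) = 2R₀M₀Lⁿη -/

/-- Inclusion form of *"dist(Ω_n(□)ᶜ, Ω_{n+1}(□)) = 2R₀M₀Lⁿη"*: every point within sup-distance collar n of
Ω_{n+1}(□) lies in Ω_n(□) (n < j). [cite: Balaban1985BackgroundPropagators, p. 408 (PDF p. 20)] -/
theorem dist_succ (c : Fin d → ℝ) (K R₀ M₀ L η : ℝ) {j n : ℕ} (h : n < j) {x y : Fin d → ℝ}
    (hx : x ∈ Omega c K R₀ M₀ L η j (n + 1)) (hxy : ∀ i, |y i - x i| ≤ collar R₀ M₀ L η n) :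
    y ∈ Omega c K R₀ M₀ L η j n := by
  intro i
  rw [rad_succ K R₀ M₀ L η h]
  have h1 := abs_sub_le (y i) (x i) (c i)
  linarith [hx i, hxy i]

/-- Sharpness: the printed distance is ATTAINED — for every ε > 0 there are x ∈ Ω_{n+1}(□) and y ∉ Ω_n(□) within
sup-distance collar n + ε of each other (d ≧ 1, non-negative radii). [folklore] -/
theorem dist_succ_sharp (c : Fin d → ℝ) {K R₀ M₀ L η : ℝ} (hK : 0 ≤ K) (hR : 0 ≤ R₀) (hM : 0 ≤ M₀) (hL : 0 ≤ L)
    (hη : 0 ≤ η) {j n : ℕ} (h : n < j) (i₀ : Fin d) {ε : ℝ} (hε : 0 < ε) :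
    ∃ x ∈ Omega c K R₀ M₀ L η j (n + 1), ∃ y ∉ Omega c K R₀ M₀ L η j n,
      ∀ i, |y i - x i| ≤ collar R₀ M₀ L η n + ε := by
  have hr0 : 0 ≤ rad K R₀ M₀ L η j (n + 1) := by
    unfold rad
    exact add_nonneg (by positivity) (Finset.sum_nonneg fun k _ => collar_nonneg hR hM hL hη k)
  have hc0 := collar_nonneg hR hM hL hη n
  refine ⟨fun i => if i = i₀ then c i + rad K R₀ M₀ L η j (n + 1) else c i, fun i => ?_,
    fun i => if i = i₀ then c i + rad K R₀ M₀ L η j (n + 1) + collar R₀ M₀ L η n + ε else c i,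
    fun hy => ?_, fun i => ?_⟩
  · by_cases hi : i = i₀
    · simp only [hi, if_true, add_sub_cancel_left]
      rw [abs_of_nonneg hr0]
    · simp only [hi, if_false, sub_self, abs_zero]; exact hr0
  · have := hy i₀
    simp only [if_true] at this
    rw [rad_succ K R₀ M₀ L η h] at this
    have h2 : c i₀ + rad K R₀ M₀ L η j (n + 1) + collar R₀ M₀ L η n + ε - c i₀
        = rad K R₀ M₀ L η j (n + 1) + collar R₀ M₀ L η n + ε := by ring
    rw [h2, abs_of_nonneg (by linarith)] at this
    linarith
  · by_cases hi : i = i₀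
    · simp only [hi, if_true]
      have h2 : c i₀ + rad K R₀ M₀ L η j (n + 1) + collar R₀ M₀ L η n + ε - (c i₀ + rad K R₀ M₀ L η j (n + 1))
          = collar R₀ M₀ L η n + ε := by ring
      rw [h2, abs_of_nonneg (by linarith)]
    · simp only [hi, if_false, sub_self, abs_zero]; linarith

/-! ## §4  The printed closed form and the bound < 2R₀M₀L^jη -/

/-- Σ_{m=n}^{j−1} Lᵐ = Lⁿ·(L^{j−n} − 1)/(L − 1) for L ≠ 1 (meant for n ≦ j; for n > j both sides vanish, j − n being
truncated subtraction). [folklore] -/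
theorem sum_pow_Ico_eq {L : ℝ} (hL : L ≠ 1) (n j : ℕ) :
    ∑ m ∈ Finset.Ico n j, L ^ m = L ^ n * ((L ^ (j - n) - 1) / (L - 1)) := by
  rw [Finset.sum_Ico_eq_sum_range, ← geom_sum_eq hL (j - n), Finset.mul_sum]
  refine Finset.sum_congr rfl fun k _ => ?_
  rw [pow_add]

/-- The printed closed form of the accumulated collars:
2R₀M₀Lⁿη + ⋯ + 2R₀M₀L^{j−1}η = 2R₀M₀Lⁿη·(L^{j−n} − 1)/(L − 1) (L ≠ 1; meant for n ≦ j).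
[cite: Balaban1985BackgroundPropagators, p. 408 (PDF p. 20)] -/
theorem sum_collar_eq {R₀ M₀ L η : ℝ} (hL : L ≠ 1) (n j : ℕ) :
    ∑ m ∈ Finset.Ico n j, collar R₀ M₀ L η m
      = 2 * R₀ * M₀ * (L ^ n * η) * ((L ^ (j - n) - 1) / (L - 1)) := by
  have h1 : ∑ m ∈ Finset.Ico n j, collar R₀ M₀ L η m = 2 * R₀ * M₀ * η * ∑ m ∈ Finset.Ico n j, L ^ m := by
    rw [Finset.mul_sum]
    exact Finset.sum_congr rfl fun m _ => by unfold collar; ring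
  rw [h1, sum_pow_Ico_eq hL n j]
  ring

/-- Hence *"dist(Ω_n(□)ᶜ, □̃⁴)"* = rad n − 5ML^jη has the printed value: rad n = 5ML^jη + 2R₀M₀Lⁿη(L^{j−n} − 1)/(L − 1).
[cite: Balaban1985BackgroundPropagators, p. 408 (PDF p. 20)] -/
theorem rad_closed_form {K R₀ M₀ L η : ℝ} (hL : L ≠ 1) (n j : ℕ) :
    rad K R₀ M₀ L η j n
      = 5 * (K * R₀ * M₀) * (L ^ j * η) + 2 * R₀ * M₀ * (L ^ n * η) * ((L ^ (j - n) - 1) / (L - 1)) := by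
  unfold rad; rw [sum_collar_eq hL n j]

/-- For L ≧ 2 the geometric sum stays below the next power: Σ_{m=n}^{j−1} Lᵐ < L^j (indeed ≦ L^j − Lⁿ… we only need <).
[folklore] -/
theorem sum_pow_Ico_lt {L : ℝ} (hL : 2 ≤ L) (n j : ℕ) : ∑ m ∈ Finset.Ico n j, L ^ m < L ^ j := by
  have hsub : Finset.Ico n j ⊆ Finset.range j := fun m hm => by
    rw [Finset.mem_range]; exact (Finset.mem_Ico.mp hm).2
  have hle : ∑ m ∈ Finset.Ico n j, L ^ m ≤ ∑ m ∈ Finset.range j, L ^ m :=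
    Finset.sum_le_sum_of_subset_of_nonneg hsub fun m _ _ => pow_nonneg (by linarith) m
  have hgeom : (∑ m ∈ Finset.range j, L ^ m) * (L - 1) = L ^ j - 1 := geom_sum_mul L j
  have hS0 : 0 ≤ ∑ m ∈ Finset.range j, L ^ m := Finset.sum_nonneg fun m _ => pow_nonneg (by linarith) m
  have hS : ∑ m ∈ Finset.range j, L ^ m ≤ L ^ j - 1 := by nlinarith
  linarith

/-- *"For n = 0 we have dist(Ω₀(□)ᶜ, □̃⁴) < 2R₀M₀L^jη"* — in fact for every n: the accumulated collars stay below
ONE collar of the top scale, for L ≧ 2 and R₀, M₀, η > 0. [cite: Balaban1985BackgroundPropagators, p. 408 (PDF p. 20)] -/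
theorem sum_collar_lt {R₀ M₀ L η : ℝ} (hR : 0 < R₀) (hM : 0 < M₀) (hL : 2 ≤ L) (hη : 0 < η) (n j : ℕ) :
    ∑ m ∈ Finset.Ico n j, collar R₀ M₀ L η m < collar R₀ M₀ L η j := by
  have h1 : ∑ m ∈ Finset.Ico n j, collar R₀ M₀ L η m = 2 * R₀ * M₀ * η * ∑ m ∈ Finset.Ico n j, L ^ m := by
    rw [Finset.mul_sum]
    exact Finset.sum_congr rfl fun m _ => by unfold collar; ring
  have h2 : collar R₀ M₀ L η j = 2 * R₀ * M₀ * η * L ^ j := by unfold collar; ring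
  rw [h1, h2]
  exact mul_lt_mul_of_pos_left (sum_pow_Ico_lt hL n j) (by positivity)

/-- *"hence Ω₀(□) ⊂ □̃⁵"* (□̃⁵ = box of half-width 6ML^jη): holds for every Ω_n(□), n ≦ j, as soon as K ≥ 2 —
the extra collar 2R₀M₀L^jη must fit into ML^jη = KR₀M₀L^jη (cell C-B9-10; `K_one_counterexample` below).
[cite: Balaban1985BackgroundPropagators, p. 408 (PDF p. 20)] -/
theorem Omega_subset_tilde_five (c : Fin d → ℝ) {K R₀ M₀ L η : ℝ} (hK : 2 ≤ K) (hR : 0 < R₀) (hM : 0 < M₀)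
    (hL : 2 ≤ L) (hη : 0 < η) (j n : ℕ) :
    Omega c K R₀ M₀ L η j n ⊆ tilde c (K * R₀ * M₀ * (L ^ j * η)) 5 := by
  refine box_mono c ?_
  have h1 := sum_collar_lt hR hM hL hη n j
  have h2 : collar R₀ M₀ L η j ≤ K * R₀ * M₀ * (L ^ j * η) := by
    unfold collar
    have : 0 < R₀ * M₀ * (L ^ j * η) := by positivity
    nlinarith
  unfold rad
  push_cast
  nlinarith

/-- Sharpness of K ≥ 2: with K = 1 (M = R₀M₀, excluded by print's "much bigger than M₀") the inclusion Ω₀(□) ⊂ □̃⁵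
FAILS — d = 1, L = 2, j = 2, R₀ = M₀ = η = 1, c = 0: Ω₀ = [−26, 26] but □̃⁵ = [−24, 24]. [folklore] -/
theorem K_one_counterexample :
    ¬ (Omega (fun _ : Fin 1 => (0 : ℝ)) 1 1 1 2 1 2 0 ⊆ tilde (fun _ : Fin 1 => (0 : ℝ)) (1 * 1 * 1 * (2 ^ 2 * 1)) 5) := by
  intro h
  have hx : (fun _ : Fin 1 => (26 : ℝ)) ∈ Omega (fun _ : Fin 1 => (0 : ℝ)) 1 1 1 2 1 2 0 := by
    intro i
    simp only [rad, collar, sub_zero]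
    rw [Finset.sum_Ico_eq_sum_range]
    norm_num [Finset.sum_range_succ]
  have := h hx 0
  norm_num at this

/-! ## §5  Condition (2.2) for the local sequence -/

/-- The collar in scale-n units: (Lⁿη)^{−1}·2R₀M₀Lⁿη = 2R₀M₀. [folklore] -/
theorem collar_div_unit {R₀ M₀ L η : ℝ} (hL : 0 < L) (hη : 0 < η) (n : ℕ) :
    collar R₀ M₀ L η n / (L ^ n * η) = 2 * R₀ * M₀ := by
  unfold collar
  rw [mul_div_assoc, div_self (by positivity), mul_one]

/-- (2.2) *"(L^jη)^{−1} dist(Ω_j^c, Ω_{j+1}) > RM"* for the local sequence in the (R, M) ↦ (R₀, M₀) reading suggested by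
p. 408 (*"Let us fix a pair R₀, M₀ of smallest possible numbers satisfying conditions needed in the proofs"*): the
rescaled shell width 2R₀M₀ exceeds R₀M₀ strictly. [cite: Balaban1984PropagatorsII, (2.2) p. 224 (PDF p. 2);
Balaban1985BackgroundPropagators, p. 408 (PDF p. 20), "This sequence satisfies the conditions (2.1), (2.2)"] -/
theorem cond22_local {R₀ M₀ L η : ℝ} (hR : 0 < R₀) (hM : 0 < M₀) (hL : 0 < L) (hη : 0 < η) (n : ℕ) :
    R₀ * M₀ < collar R₀ M₀ L η n / (L ^ n * η) := by
  rw [collar_div_unit hL hη]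
  nlinarith [mul_pos hR hM]

/-! ## §6  Lattice compatibility: «it is a sum of big blocks» -/

/-- For natural K, R₀, L the half-width of Ω_n(□) is a NATURAL multiple of the scale-n block unit M₀Lⁿη:
rad n = (5KR₀L^{j−n} + 2R₀·Σ_{m=n}^{j−1} L^{m−n})·M₀Lⁿη (n ≦ j).
[cite: Balaban1984PropagatorsII, (2.2) p. 224 (PDF p. 2), "it is a sum of big blocks"] -/
theorem rad_eq_natMul (K R₀ L : ℕ) (M₀ η : ℝ) {n j : ℕ} (hnj : n ≤ j) :
    rad (K : ℝ) (R₀ : ℝ) M₀ (L : ℝ) η j n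
      = ((5 * K * R₀ * L ^ (j - n) + 2 * R₀ * ∑ k ∈ Finset.range (j - n), L ^ k : ℕ) : ℝ) * (M₀ * ((L : ℝ) ^ n * η)) := by
  unfold rad collar
  rw [Finset.sum_Ico_eq_sum_range]
  push_cast
  have hj : (L : ℝ) ^ j = (L : ℝ) ^ n * (L : ℝ) ^ (j - n) := by rw [← pow_add, Nat.add_sub_cancel' hnj]
  rw [hj, add_mul, Finset.mul_sum, Finset.sum_mul]
  congr 1
  · ring
  · exact Finset.sum_congr rfl fun k _ => by rw [pow_add]; ring

/-- Faces on the lattice: if the centre coordinate lies on the ML^jη-lattice (M = KR₀M₀; centres of 𝒟_j cubes do)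
then both faces c_i ± rad n lie on the M₀Lⁿη-lattice (n ≦ j) — Ω_n(□) is a union of cells of that lattice.
[cite: Balaban1984PropagatorsII, (2.2) p. 224 (PDF p. 2), "Ω_j^{(j)} ⊂ T^{(j)}_{L^jη} and it is a sum of big blocks"] -/
theorem face_on_lattice (K R₀ L : ℕ) (M₀ η : ℝ) {n j : ℕ} (hnj : n ≤ j) {t : ℝ} {z : ℤ}
    (ht : t = (z : ℝ) * ((K : ℝ) * R₀ * M₀ * ((L : ℝ) ^ j * η))) :
    (∃ z' : ℤ, t + rad (K : ℝ) (R₀ : ℝ) M₀ (L : ℝ) η j n = (z' : ℝ) * (M₀ * ((L : ℝ) ^ n * η))) ∧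
    (∃ z' : ℤ, t - rad (K : ℝ) (R₀ : ℝ) M₀ (L : ℝ) η j n = (z' : ℝ) * (M₀ * ((L : ℝ) ^ n * η))) := by
  set N : ℕ := 5 * K * R₀ * L ^ (j - n) + 2 * R₀ * ∑ k ∈ Finset.range (j - n), L ^ k with hN
  have hrad : rad (K : ℝ) (R₀ : ℝ) M₀ (L : ℝ) η j n = (N : ℝ) * (M₀ * ((L : ℝ) ^ n * η)) := by
    rw [hN]; exact rad_eq_natMul K R₀ L M₀ η hnj
  have hj : (L : ℝ) ^ j = (L : ℝ) ^ n * (L : ℝ) ^ (j - n) := by rw [← pow_add, Nat.add_sub_cancel' hnj]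
  have ht' : t = ((z * (K * R₀ * L ^ (j - n) : ℕ) : ℤ) : ℝ) * (M₀ * ((L : ℝ) ^ n * η)) := by
    rw [ht, hj]; push_cast; ring
  refine ⟨⟨z * (K * R₀ * L ^ (j - n) : ℕ) + N, ?_⟩, ⟨z * (K * R₀ * L ^ (j - n) : ℕ) - N, ?_⟩⟩
  · rw [hrad, ht']; push_cast; ring
  · rw [hrad, ht']; push_cast; ring

/-! ## §7  The second case: the top step Ω_{j+1}(□) = □̃³ ∩ B^{j+1}(Λ_{j+1}) -/

/-- Case 2 of p. 408: Ω_{j+1}(□) = □̃³ ∩ B^{j+1}(Λ_{j+1}) ⊆ □̃³ ⊆ □̃⁴ = Ω_j(□) (M′ = ML^jη ≧ 0; B arbitrary).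
[cite: Balaban1985BackgroundPropagators, p. 408 (PDF p. 20), "we defined Ω_{j+1}(□) = □̃³ ∩ B^{j+1}(Λ_{j+1})"] -/
theorem case2_top_subset (c : Fin d → ℝ) {M' : ℝ} (hM' : 0 ≤ M') (B : Set (Fin d → ℝ)) :
    tilde c M' 3 ∩ B ⊆ tilde c M' 4 := by
  intro x hx
  refine box_mono c ?_ hx.1
  push_cast; nlinarith

/-- Case 2, the top shell: every point within sup-distance M′ = ML^jη of □̃³ (⊇ Ω_{j+1}(□)) lies in □̃⁴ = Ω_j(□); in
scale-j units the width is M = KR₀M₀ ≧ 2R₀M₀ > R₀M₀ for K ≥ 2, so (2.2) holds at this step too. [folklore] -/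
theorem case2_top_dist (c : Fin d → ℝ) (M' : ℝ) {x y : Fin d → ℝ} (hx : x ∈ tilde c M' 3)
    (hxy : ∀ i, |y i - x i| ≤ M') : y ∈ tilde c M' 4 := by
  intro i
  have h1 := abs_sub_le (y i) (x i) (c i)
  have hx' := hx i
  push_cast at hx' ⊢
  linarith [hxy i]

/-- … and the (2.2)-margin of that step in the (R₀, M₀) reading: KR₀M₀ > R₀M₀ as soon as K ≥ 2. [folklore] -/
theorem case2_top_cond22 {K R₀ M₀ : ℝ} (hK : 2 ≤ K) (hR : 0 < R₀) (hM : 0 < M₀) : R₀ * M₀ < K * R₀ * M₀ := by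
  nlinarith [mul_pos hR hM]

/-! ## §8  Sanity instances -/

example : collar (1 : ℝ) 1 2 1 3 = 16 := by norm_num [collar]

example : rad (2 : ℝ) 1 1 2 1 2 0 = 46 := by
  simp only [rad, collar]
  rw [Finset.sum_Ico_eq_sum_range]
  norm_num [Finset.sum_range_succ]

end Literature.MathematicalPhysics.QuantumFieldTheory.Balaban1983to89.B9SectCLocalSeq
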